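import Literature.MathematicalPhysics.StatisticalMechanics.ComplexSpinTwistedPartitionFunction
import Literature.MathematicalPhysics.StatisticalMechanics.ComplexSpinGaussianDomination
import HarnessLib

/-!
# Gaussian domination for complex spin systems with a GENERAL reflection-positive weight
# (Fröhlich–Israel–Lieb–Simon 1978; Salmhofer–Seiler, CMP 139 (1991), Thm. 3.20 and (3.80)–(3.97))

The tree's discharge of Salmhofer–Seiler's infrared bound (`ComplexSpinReflectionPositivity`,
`ComplexSpinExponentialSchwarz`, `ComplexSpinChessboard`, `ComplexSpinGaussianDomination`,
`ComplexSpinTwistedPartitionFunction`, `ComplexSpinInfraredBoundProof`) is written for the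
NEAREST-NEIGHBOUR background bracket `[Φ]_Λ = [∏σ^N](Φ · ∏_x F(σ_x) ∏_{xy} B(σ_xσ_y))` (3.78) of a
complex spin system, whose reflection positivity comes from `b_k ≥ 0` (Remark 4.5).  The
Fröhlich–Israel–Lieb–Simon mechanism behind it uses nothing of the product form: only (i) the
coefficient-extraction bracket `Φ ↦ [Φ · W]₀` of SOME weight `W ∈ 𝒜_Λ`, (ii) `ΘW = W` and (iii)
`[A · ΘA · W]₀ ≥ 0` for all `A ∈ 𝒜_{Λ₊}`, for every reflection plane.  This file re-runs the chain
for an ARBITRARY such weight `W` (`bracketW N W`, `IsRPWeight i k N W`):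

* the Schwarz inequality (3.54) `bracketW_schwarz`, its polarised/positive-combination form, and
  **Thm. 3.20** `expBracketW_schwarz` / `expBracketW_diag` (exponential Schwarz inequality);
* the twisted partition functions `Z^ε_W(φ) = [e^{−N H^ε_Λ(φ)} · W]₀` (`twistedZW`), the per-plane
  regrouping (3.84)–(3.89) `twistedZW_eq_expBracketW`, the reflection Schwarz inequality **(3.90)**
  `twistedZW_schwarz`, the chessboard bound `norm_twistedZW_le_pattern` (via the tree's abstract
  `chessboard_cfg`), and **Gaussian domination (3.95)/(3.97)** `gaussianDominationW_one` /
  `gaussianDominationW_negOne`: `|Z^±_W(φ)| ≤ |Z^±_W(0)|` for real resp. imaginary `φ`, for every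
  `W` that is an RP weight for ALL planes of the even torus;
* consistency: the nearest-neighbour bracket is the case `W = boltzmannC N f b`
  (`bracketC_eq_bracketW`, `isRPWeight_boltzmannC`).

All proofs are those of the cited tree files with the weight abstracted (the weight-independent
algebra — `eT`, `expPartial`, `NullEq`, `hamFamily`, `plusHam`, `cfgSymP`, `pattern`,
`chessboard_cfg`, … — is imported, not copied).  Purpose (cell pub-ymgap, seat qcd-lit g21, ladder
row Q1): the `β > 0` programme for compact lattice QED needs the Gaussian-domination machinery "with a
non-local cone remainder", i.e. for the `β`-dressed meson weight, which is not of product form; its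
reflection positivity is `StaggeredGaugeGaussianCorrectedReflectionPositivity`.  Honest framing:
finite-volume algebra of polynomial spin systems; no infrared bound is extracted here (next file);
nothing about `β`, the continuum or the summit's `QCD` conjunct.  0 facts, 0 sorry.

## References

* J. Fröhlich, R. Israel, E. H. Lieb, B. Simon, *Phase transitions and reflection positivity. I*,
  Commun. Math. Phys. 62 (1978) 1–34, §§2–4 (Schwarz inequality, exponential form, chessboard
  estimates, Gaussian domination for a general RP functional). [FrohlichIsraelLiebSimon1978]
* M. Salmhofer, E. Seiler, Commun. Math. Phys. 139 (1991) 395–432, Remark 3.16 (3.54), Thm. 3.20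
  (3.70), (3.78)–(3.97). [SalmhoferSeiler1991]
-/

noncomputable section

open MvPolynomial Finset

namespace Literature.MathematicalPhysics.StatisticalMechanics

open Literature.Probability.LatticeModels (TorusSite)
open Literature.Barriers.CriticalPhenomena.NonGibbs

namespace ComplexSpin

variable {ν L : ℕ} [NeZero L]

/-! ### The bracket of a general weight and reflection-positive weights -/

/-- **The coefficient-extraction bracket of a general weight** `W ∈ 𝒜_Λ`:
`[Φ]_W = ` the coefficient of `∏_x σ_x^N` in `Φ · W` (Remark 3.2; the nearest-neighbour background
bracket (3.78) is the case `W = ∏F∏B`, `bracketC_eq_bracketW`). [cite: SalmhoferSeiler1991, (3.78) and Remark 3.2] -/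
def bracketW (N : ℕ) (W Φ : FieldAlg ν L) : ℂ :=
  coeff (topExponent N) (Φ * W)

/-- The nearest-neighbour bracket is the bracket of the Boltzmann polynomial. [cite: SalmhoferSeiler1991, (3.78)] -/
theorem bracketC_eq_bracketW (N : ℕ) (f b : ℕ → ℝ) (Φ : FieldAlg ν L) :
    bracketC N f b Φ = bracketW N (boltzmannC N f b) Φ := rfl

/-- **Reflection-positive weights** for the plane `(i, k)`: `ΘW = W` and `[A · ΘA]_W` real `≥ 0` for
every `A ∈ 𝒜_{Λ₊}` — the two properties of the background bracket (3.78) that the proof of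
Thm. 3.21 uses ("`[·]_Λ` is reflection-positive", p. 414; Fröhlich–Israel–Lieb–Simon's standing
hypothesis). [cite: FrohlichIsraelLiebSimon1978, §2] -/
structure IsRPWeight (i : Fin ν) (k : ZMod L) (N : ℕ) (W : FieldAlg ν L) : Prop where
  /-- reflection invariance of the weight -/
  refl : reflect i k W = W
  /-- `[A ΘA]_W` is real and non-negative on the positive algebra -/
  nonneg : ∀ {A : FieldAlg ν L}, A ∈ plusAlgebra i k →
    bracketW N W (A * reflect i k A) = ((bracketW N W (A * reflect i k A)).re : ℂ) ∧
      0 ≤ (bracketW N W (A * reflect i k A)).re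

/-- **The nearest-neighbour Boltzmann polynomial with `b_k ≥ 0` is an RP weight for every plane**
(Prop. 3.15 / Remark 4.5, the tree's `bracketC_mul_reflect_nonneg` and `reflect_boltzmannC`). [cite: SalmhoferSeiler1991, Prop. 3.15] -/
theorem isRPWeight_boltzmannC (hL : Even L) (i : Fin ν) (k : ZMod L) (N : ℕ) (f : ℕ → ℝ) {b : ℕ → ℝ}
    (hb : ∀ j ≤ N, 0 ≤ b j) : IsRPWeight i k N (boltzmannC (ν := ν) (L := L) N f b) :=
  ⟨reflect_boltzmannC N f b, fun hA => bracketC_mul_reflect_nonneg hL i k f hb hA⟩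

/-! ### Linearity, reflection symmetry, blindness above the top degree -/

/-- `[·]_W` is additive. [cite: SalmhoferSeiler1991, Remark 3.2] -/
theorem bracketW_add (N : ℕ) (W Φ Ψ : FieldAlg ν L) :
    bracketW N W (Φ + Ψ) = bracketW N W Φ + bracketW N W Ψ := by
  rw [bracketW, bracketW, bracketW, add_mul, coeff_add]

/-- `[Φ − Ψ]_W = [Φ]_W − [Ψ]_W`. [cite: SalmhoferSeiler1991, Remark 3.2] -/
theorem bracketW_sub (N : ℕ) (W Φ Ψ : FieldAlg ν L) :
    bracketW N W (Φ - Ψ) = bracketW N W Φ - bracketW N W Ψ := by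
  rw [bracketW, bracketW, bracketW, sub_mul, coeff_sub]

/-- `[c Φ]_W = c [Φ]_W`. [cite: SalmhoferSeiler1991, Remark 3.2] -/
theorem bracketW_C_mul (N : ℕ) (W : FieldAlg ν L) (c : ℂ) (Φ : FieldAlg ν L) :
    bracketW N W (C c * Φ) = c * bracketW N W Φ := by
  rw [bracketW, bracketW, mul_assoc, coeff_C_mul]

/-- `[Σ_a Φ_a]_W = Σ_a [Φ_a]_W`. [cite: SalmhoferSeiler1991, Remark 3.2] -/
theorem bracketW_sum (N : ℕ) (W : FieldAlg ν L) {α : Type*} (s : Finset α) (Φ : α → FieldAlg ν L) :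
    bracketW N W (∑ a ∈ s, Φ a) = ∑ a ∈ s, bracketW N W (Φ a) := by
  rw [bracketW, Finset.sum_mul, coeff_sum]
  rfl

/-- **The bracket is blind above the top degree.** [cite: SalmhoferSeiler1991, Remark 3.2] -/
theorem bracketW_eq_zero_of_minDegree {N : ℕ} (W : FieldAlg ν L) {P : FieldAlg ν L}
    (hP : MinDegree (topDegree ν L N + 1) P) : bracketW N W P = 0 := by
  rw [bracketW]
  exact coeff_eq_zero_of_minDegree (hP.mul_right _) (by rw [degree_topExponent]; exact Nat.lt_succ_self _)

/-- Congruent observables have the same brackets. [cite: SalmhoferSeiler1991, Remark 3.2] -/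
theorem bracketW_congr_of_nullEq {N : ℕ} (W : FieldAlg ν L) {P P' : FieldAlg ν L}
    (h : NullEq (topDegree ν L N) P P') (R : FieldAlg ν L) :
    bracketW N W (R * P) = bracketW N W (R * P') := by
  have h0 : bracketW N W (R * (P - P')) = 0 := bracketW_eq_zero_of_minDegree W (MinDegree.mul_left R h)
  rw [mul_sub, bracketW_sub] at h0
  exact sub_eq_zero.1 h0

variable {i : Fin ν} {k : ZMod L}

/-- `[ΘΦ]_W = conj [Φ]_W` for a reflection-invariant weight. [cite: SalmhoferSeiler1991, Prop. 3.15 (proof)] -/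
theorem bracketW_reflect {N : ℕ} {W : FieldAlg ν L} (hW : reflect i k W = W) (Φ : FieldAlg ν L) :
    bracketW N W (reflect i k Φ) = starRingEnd ℂ (bracketW N W Φ) := by
  unfold bracketW
  conv_lhs => rw [← hW, ← map_mul]
  exact coeff_top_reflect i k N _

/-- **Hermitian symmetry** `[B · ΘA]_W = conj [A · ΘB]_W`. [cite: SalmhoferSeiler1991, Remark 3.16] -/
theorem bracketW_mul_reflect_symm {N : ℕ} {W : FieldAlg ν L} (hW : reflect i k W = W) (A B : FieldAlg ν L) :
    bracketW N W (B * reflect i k A) = starRingEnd ℂ (bracketW N W (A * reflect i k B)) := by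
  rw [← bracketW_reflect hW, map_mul, reflect_reflect, mul_comm]

/-! ### The Schwarz inequality (3.54) -/

/-- **Remark 3.16 for a general RP weight**: `|[AΘB]_W|² ≤ [AΘA]_W [BΘB]_W` for `A, B ∈ 𝒜_{Λ₊}`. [cite: SalmhoferSeiler1991, Remark 3.16 (3.54)] -/
theorem bracketW_schwarz {N : ℕ} {W : FieldAlg ν L} (hW : IsRPWeight i k N W) {A B : FieldAlg ν L}
    (hA : A ∈ plusAlgebra i k) (hB : B ∈ plusAlgebra i k) :
    Complex.normSq (bracketW N W (A * reflect i k B)) ≤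
      (bracketW N W (A * reflect i k A)).re * (bracketW N W (B * reflect i k B)).re := by
  set z : ℂ := bracketW N W (A * reflect i k B) with hz
  obtain ⟨ha, ha0⟩ := hW.nonneg hA
  obtain ⟨hc, hc0⟩ := hW.nonneg hB
  set a : ℝ := (bracketW N W (A * reflect i k A)).re with ha'
  set c : ℝ := (bracketW N W (B * reflect i k B)).re with hc'
  have hzbar : bracketW N W (B * reflect i k A) = starRingEnd ℂ z := bracketW_mul_reflect_symm hW.refl A B
  have hq : ∀ s : ℝ, 0 ≤ Complex.normSq z * c * (s * s) + (-(2 * Complex.normSq z)) * s + a := by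
    intro s
    set t : ℂ := (s : ℂ) * z with ht
    have hD : A - C t * B ∈ plusAlgebra i k :=
      Subalgebra.sub_mem _ hA (Subalgebra.mul_mem _ (C_mem_plusAlgebra i k t) hB)
    obtain ⟨hd, hd0⟩ := hW.nonneg hD
    have hexp : (A - C t * B) * reflect i k (A - C t * B) =
        A * reflect i k A - C (starRingEnd ℂ t) * (A * reflect i k B) - C t * (B * reflect i k A) +
          C (t * starRingEnd ℂ t) * (B * reflect i k B) := by
      simp only [map_sub, map_mul, reflect_C]
      ring
    have hval : bracketW N W ((A - C t * B) * reflect i k (A - C t * B)) =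
        ((Complex.normSq z * c * (s * s) + (-(2 * Complex.normSq z)) * s + a : ℝ) : ℂ) := by
      rw [hexp, bracketW_add, bracketW_sub, bracketW_sub, bracketW_C_mul, bracketW_C_mul, bracketW_C_mul, hzbar,
        ← hz, ha, hc, ht, map_mul, Complex.conj_ofReal]
      have h1 : (starRingEnd ℂ) z * z = (Complex.normSq z : ℂ) := Complex.normSq_eq_conj_mul_self.symm
      have h2 : z * (starRingEnd ℂ) z = (Complex.normSq z : ℂ) := Complex.mul_conj z
      push_cast
      linear_combination (-(s : ℂ)) * h1 + (-(s : ℂ) + (s : ℂ) ^ 2 * (c : ℂ)) * h2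
    have := hd0
    rw [hval, Complex.ofReal_re] at this
    exact this
  have hdisc := discrim_le_zero hq
  rw [discrim] at hdisc
  have hn := Complex.normSq_nonneg z
  by_cases hn0 : Complex.normSq z = 0
  · rw [hn0]; exact mul_nonneg ha0 hc0
  · have hnpos : 0 < Complex.normSq z := lt_of_le_of_ne hn (Ne.symm hn0)
    nlinarith [hdisc, hnpos]

/-! ### The polarised partial exponential sums and their Schwarz inequality (general weight) -/

/-- **The generalised Schwarz inequality for positive combinations**: for `U_a, V_a ∈ 𝒜_{Λ₊}` and
weights `w_a ≥ 0`, `|∑_a w_a [U_a ΘV_a]|² ≤ (∑_a w_a [U_a ΘU_a]) (∑_a w_a [V_a ΘV_a])` — the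
termwise Schwarz inequality (3.54) followed by the Cauchy–Schwarz inequality for finite sums (the
mechanism of the proof of Thm. 3.20, "see [19]").
[cite: SalmhoferSeiler1991, Thm. 3.20 (proof) with Remark 3.16 (3.54)] -/
theorem bracketW_sum_polarized_schwarz {N : ℕ} {W : FieldAlg ν L} (hW : IsRPWeight i k N W)
    {α : Type*} (s : Finset α) {w : α → ℝ}
    (hw : ∀ a ∈ s, 0 ≤ w a) {U V : α → FieldAlg ν L} (hU : ∀ a ∈ s, U a ∈ plusAlgebra i k)
    (hV : ∀ a ∈ s, V a ∈ plusAlgebra i k) :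
    ‖∑ a ∈ s, (w a : ℂ) * bracketW N W (U a * reflect i k (V a))‖ ^ 2 ≤
      (∑ a ∈ s, (w a : ℂ) * bracketW N W (U a * reflect i k (U a))).re *
        (∑ a ∈ s, (w a : ℂ) * bracketW N W (V a * reflect i k (V a))).re := by
  -- termwise data
  set z : α → ℂ := fun a => bracketW N W (U a * reflect i k (V a)) with hz
  set p : α → ℝ := fun a => (bracketW N W (U a * reflect i k (U a))).re with hp
  set q : α → ℝ := fun a => (bracketW N W (V a * reflect i k (V a))).re with hq
  have hpz : ∀ a ∈ s, bracketW N W (U a * reflect i k (U a)) = (p a : ℂ) ∧ 0 ≤ p a :=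
    fun a ha => hW.nonneg (hU a ha)
  have hqz : ∀ a ∈ s, bracketW N W (V a * reflect i k (V a)) = (q a : ℂ) ∧ 0 ≤ q a :=
    fun a ha => hW.nonneg (hV a ha)
  -- the two right-hand sums are the real sums `∑ w p`, `∑ w q`
  have hP : (∑ a ∈ s, (w a : ℂ) * bracketW N W (U a * reflect i k (U a))).re =
      ∑ a ∈ s, w a * p a := by
    rw [Complex.re_sum]
    refine Finset.sum_congr rfl fun a ha => ?_
    rw [(hpz a ha).1, ← Complex.ofReal_mul, Complex.ofReal_re]
  have hQ : (∑ a ∈ s, (w a : ℂ) * bracketW N W (V a * reflect i k (V a))).re =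
      ∑ a ∈ s, w a * q a := by
    rw [Complex.re_sum]
    refine Finset.sum_congr rfl fun a ha => ?_
    rw [(hqz a ha).1, ← Complex.ofReal_mul, Complex.ofReal_re]
  rw [hP, hQ]
  -- `‖∑ w z‖ ≤ ∑ w ‖z‖`
  have hnorm : ‖∑ a ∈ s, (w a : ℂ) * z a‖ ≤ ∑ a ∈ s, w a * ‖z a‖ := by
    refine (norm_sum_le _ _).trans (le_of_eq (Finset.sum_congr rfl fun a ha => ?_))
    rw [norm_mul, Complex.norm_real, Real.norm_of_nonneg (hw a ha)]
  have h0 : 0 ≤ ∑ a ∈ s, w a * ‖z a‖ := Finset.sum_nonneg fun a ha => mul_nonneg (hw a ha) (norm_nonneg _)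
  -- Cauchy–Schwarz with the termwise Schwarz inequality (3.54)
  have hcs : (∑ a ∈ s, w a * ‖z a‖) ^ 2 ≤ (∑ a ∈ s, w a * p a) * ∑ a ∈ s, w a * q a := by
    refine sum_sq_le_sum_mul_sum_of_sq_le_mul s (fun a ha => mul_nonneg (hw a ha) (hpz a ha).2)
      (fun a ha => mul_nonneg (hw a ha) (hqz a ha).2) fun a ha => ?_
    have hs := bracketW_schwarz hW (hU a ha) (hV a ha)
    rw [Complex.normSq_eq_norm_sq] at hs
    have : (w a * ‖z a‖) ^ 2 = w a * w a * ‖z a‖ ^ 2 := by ring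
    rw [this]
    calc w a * w a * ‖z a‖ ^ 2 ≤ w a * w a * (p a * q a) :=
          mul_le_mul_of_nonneg_left hs (mul_nonneg (hw a ha) (hw a ha))
      _ = w a * p a * (w a * q a) := by ring
  calc ‖∑ a ∈ s, (w a : ℂ) * z a‖ ^ 2 ≤ (∑ a ∈ s, w a * ‖z a‖) ^ 2 :=
        pow_le_pow_left₀ (norm_nonneg _) hnorm 2
    _ ≤ _ := hcs


/-- The bracket of `R · S_M(C,D)` expanded. [cite: SalmhoferSeiler1991, Thm. 3.20 (proof)] -/
theorem bracketW_mul_expPartial (i : Fin ν) (k : ZMod L) (M : ℕ) {ι : Type*} [Fintype ι]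
    [DecidableEq ι] (w : ι → ℝ) (C D : ι → FieldAlg ν L) {N : ℕ} (W : FieldAlg ν L)
    (X Y : FieldAlg ν L) :
    bracketW N W (X * reflect i k Y * expPartial i k M w C D) =
      ∑ g ∈ Fintype.piFinset fun _ : ι => range (M + 1),
        ((expWeight w g : ℝ) : ℂ) *
          bracketW N W ((X * ∏ j, (C j) ^ (g j)) * reflect i k (Y * ∏ j, (D j) ^ (g j))) := by
  rw [expPartial_eq_sum, Finset.mul_sum, bracketW, Finset.sum_mul, coeff_sum]
  refine Finset.sum_congr rfl fun g _ => ?_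
  rw [bracketW, ← coeff_C_mul]
  congr 1
  rw [map_mul (reflect i k)]
  ring


/-- **The Schwarz inequality for the polarised partial sums** (the finite core of Thm. 3.20):
`|[X ΘY S_M(C,D)]|² ≤ [X ΘX S_M(C,C)] · [Y ΘY S_M(D,D)]` for `X, Y, C_j, D_j ∈ 𝒜_{Λ₊}` and
`w_j ≥ 0`. [cite: SalmhoferSeiler1991, Thm. 3.20 (3.70)] -/
theorem expPartial_schwarzW {N : ℕ} {W : FieldAlg ν L} (hW : IsRPWeight i k N W)
    (M : ℕ) {ι : Type*} [Fintype ι] {w : ι → ℝ}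
    (hw : ∀ j, 0 ≤ w j) {X Y : FieldAlg ν L} (hX : X ∈ plusAlgebra i k)
    (hY : Y ∈ plusAlgebra i k) {C D : ι → FieldAlg ν L} (hC : ∀ j, C j ∈ plusAlgebra i k)
    (hD : ∀ j, D j ∈ plusAlgebra i k) :
    ‖bracketW N W (X * reflect i k Y * expPartial i k M w C D)‖ ^ 2 ≤
      (bracketW N W (X * reflect i k X * expPartial i k M w C C)).re *
        (bracketW N W (Y * reflect i k Y * expPartial i k M w D D)).re := by
  classical
  rw [bracketW_mul_expPartial, bracketW_mul_expPartial, bracketW_mul_expPartial]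
  exact bracketW_sum_polarized_schwarz hW _ (fun g _ => expWeight_nonneg hw g)
    (fun g _ => mul_prod_pow_mem_plusAlgebra hX hC g) (fun g _ => mul_prod_pow_mem_plusAlgebra hY hD g)

/-- The diagonal partial sums `[X ΘX S_M(C,C)]` are real and nonnegative.
[cite: SalmhoferSeiler1991, Thm. 3.20 (3.70)] -/
theorem bracketW_expPartial_diag {N : ℕ} {W : FieldAlg ν L} (hW : IsRPWeight i k N W)
    (M : ℕ) {ι : Type*} [Fintype ι] {w : ι → ℝ}
    (hw : ∀ j, 0 ≤ w j) {X : FieldAlg ν L} (hX : X ∈ plusAlgebra i k) {C : ι → FieldAlg ν L}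
    (hC : ∀ j, C j ∈ plusAlgebra i k) :
    bracketW N W (X * reflect i k X * expPartial i k M w C C) =
        ((bracketW N W (X * reflect i k X * expPartial i k M w C C)).re : ℂ) ∧
      0 ≤ (bracketW N W (X * reflect i k X * expPartial i k M w C C)).re := by
  classical
  rw [bracketW_mul_expPartial]
  have h : ∀ g ∈ Fintype.piFinset (fun _ : ι => range (M + 1)),
      ((expWeight w g : ℝ) : ℂ) *
          bracketW N W ((X * ∏ j, (C j) ^ (g j)) * reflect i k (X * ∏ j, (C j) ^ (g j))) =
        ((expWeight w g *
          (bracketW N W ((X * ∏ j, (C j) ^ (g j)) * reflect i k (X * ∏ j, (C j) ^ (g j)))).re : ℝ) : ℂ) ∧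
      0 ≤ expWeight w g *
          (bracketW N W ((X * ∏ j, (C j) ^ (g j)) * reflect i k (X * ∏ j, (C j) ^ (g j)))).re := by
    intro g _
    obtain ⟨h1, h2⟩ := hW.nonneg (mul_prod_pow_mem_plusAlgebra hX hC g)
    refine ⟨?_, mul_nonneg (expWeight_nonneg hw g) h2⟩
    rw [Complex.ofReal_mul, ← h1]
  constructor
  · rw [Complex.re_sum, Complex.ofReal_sum]
    refine Finset.sum_congr rfl fun g hg => ?_
    rw [(h g hg).1, Complex.ofReal_re]
  · rw [Complex.re_sum]
    refine Finset.sum_nonneg fun g hg => ?_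
    rw [(h g hg).1, Complex.ofReal_re]
    exact (h g hg).2


/-! ### The exponential bracket of a general weight -/

/-- **Multilinear expansion of a product of finite sums inside the bracket**:
`[R · ∏_j ∑_{l ∈ t} a_{j,l} P_{j,l}] = ∑_g (∏_j a_{j,g_j}) [R · ∏_j P_{j,g_j}]`.
[cite: SalmhoferSeiler1991, Thm. 3.20 (proof)] -/
theorem bracketW_mul_prod_sum {N : ℕ} (W : FieldAlg ν L) {ι : Type*} [Fintype ι] [DecidableEq ι]
    (t : Finset ℕ) (a : ι → ℕ → ℂ) (P : ι → ℕ → FieldAlg ν L) (R : FieldAlg ν L) :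
    bracketW N W (R * ∏ j, ∑ l ∈ t, C (a j l) * P j l) =
      ∑ g ∈ Fintype.piFinset fun _ : ι => t,
        (∏ j, a j (g j)) * bracketW N W (R * ∏ j, P j (g j)) := by
  rw [Finset.prod_univ_sum, Finset.mul_sum, bracketW_sum]
  refine Finset.sum_congr rfl fun g _ => ?_
  rw [Finset.prod_mul_distrib, ← map_prod C, ← bracketW_C_mul]
  congr 1
  ring


/-- Powers of constant-free parts beyond the top degree are invisible to the bracket.
[cite: SalmhoferSeiler1991, Remark 3.2] -/
theorem bracketW_mul_prod_pow_tail_eq_zero {N : ℕ} (W : FieldAlg ν L) {ι : Type*} [Fintype ι]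
    (Q : ι → FieldAlg ν L) (R : FieldAlg ν L) {g : ι → ℕ} {j₀ : ι}
    (hg : topDegree ν L N < g j₀) :
    bracketW N W (R * ∏ j, tail (Q j) ^ (g j)) = 0 := by
  classical
  apply bracketW_eq_zero_of_minDegree
  refine MinDegree.mul_left R ?_
  have h1 : ∀ j, MinDegree (g j) (tail (Q j) ^ (g j)) := fun j => by
    simpa using (MinDegree.one_of_coeff_zero (coeff_zero_tail (Q j))).pow (g j)
  have : MinDegree (g j₀) (∏ j, tail (Q j) ^ (g j)) := by
    rw [← Finset.mul_prod_erase Finset.univ _ (Finset.mem_univ j₀)]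
    exact (h1 j₀).mul_right _
  exact this.mono hg

/-- **The bracket of a product of truncated exponentials, expanded around the constant terms**:
for `M ≥ N·|Λ|`,
`[R ∏_j e_M^{Q_j}] = ∑_{g ≤ N·|Λ|} (∏_j es_{M-g_j}(q_j) / g_j!) [R ∏_j (Q_j - q_j)^{g_j}]`.
[cite: SalmhoferSeiler1991, Thm. 3.20 (proof)] -/
theorem bracketW_mul_prod_eT {N : ℕ} (W : FieldAlg ν L) {ι : Type*} [Fintype ι] [DecidableEq ι]
    (Q : ι → FieldAlg ν L) (R : FieldAlg ν L) {M : ℕ} (hM : topDegree ν L N ≤ M) :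
    bracketW N W (R * ∏ j, eT M (Q j)) =
      ∑ g ∈ Fintype.piFinset fun _ : ι => range (topDegree ν L N + 1),
        (∏ j, es (M - g j) (cst (Q j)) * (((g j).factorial : ℂ)⁻¹)) *
          bracketW N W (R * ∏ j, tail (Q j) ^ (g j)) := by
  have h1 : (∏ j, eT M (Q j)) = ∏ j, ∑ l ∈ range (M + 1),
      C (es (M - l) (cst (Q j)) * ((l.factorial : ℂ)⁻¹)) * tail (Q j) ^ l := by
    refine Finset.prod_congr rfl fun j _ => ?_
    rw [← eT_C_add, C_cst_add_tail]
  rw [h1, bracketW_mul_prod_sum]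
  symm
  refine Finset.sum_subset (Fintype.piFinset_subset _ _ fun _ => Finset.range_subset_range.2
    (Nat.succ_le_succ hM)) fun g hg hg' => ?_
  -- a multi-index outside the small box has a coordinate above the top degree
  rw [Fintype.mem_piFinset] at hg hg'
  push Not at hg'
  obtain ⟨j₀, hj₀⟩ := hg'
  rw [Finset.mem_range, not_lt] at hj₀
  rw [bracketW_mul_prod_pow_tail_eq_zero W Q R (Nat.lt_of_succ_le hj₀), mul_zero]

/-- **The exponential bracket** `[R · ∏_j e^{Q_j}]_Λ := (∏_j e^{q_j}) [R · ∏_j e_{N|Λ|}^{Q_j - q_j}]_Λ`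
(`q_j` the constant term of `Q_j`): the value of the convergent exponential series of the
observables `Q_j` inside the bracket (`tendsto_bracketW_mul_prod_eT`).
[cite: SalmhoferSeiler1991, Thm. 3.20 (3.70)] -/
def expBracketW (N : ℕ) (W : FieldAlg ν L) {ι : Type*} [Fintype ι] (R : FieldAlg ν L)
    (Q : ι → FieldAlg ν L) : ℂ :=
  (∏ j, Complex.exp (cst (Q j))) * bracketW N W (R * ∏ j, eT (topDegree ν L N) (tail (Q j)))

/-- The exponential bracket expanded over multi-indices. [cite: SalmhoferSeiler1991, Thm. 3.20 (proof)] -/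
theorem expBracketW_eq_sum {N : ℕ} (W : FieldAlg ν L) {ι : Type*} [Fintype ι] [DecidableEq ι]
    (R : FieldAlg ν L) (Q : ι → FieldAlg ν L) :
    expBracketW N W R Q =
      ∑ g ∈ Fintype.piFinset fun _ : ι => range (topDegree ν L N + 1),
        (∏ j, Complex.exp (cst (Q j)) * (((g j).factorial : ℂ)⁻¹)) *
          bracketW N W (R * ∏ j, tail (Q j) ^ (g j)) := by
  rw [expBracketW]
  unfold eT
  rw [bracketW_mul_prod_sum, Finset.mul_sum]
  refine Finset.sum_congr rfl fun g _ => ?_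
  rw [← mul_assoc, ← Finset.prod_mul_distrib]

/-- **Convergence of the exponential series inside the bracket**:
`[R · ∏_j e_M^{Q_j}]_Λ → [R · ∏_j e^{Q_j}]_Λ` as `M → ∞`.
[cite: SalmhoferSeiler1991, Thm. 3.20 (proof)] -/
theorem tendsto_bracketW_mul_prod_eT {N : ℕ} (W : FieldAlg ν L) {ι : Type*} [Fintype ι]
    (R : FieldAlg ν L) (Q : ι → FieldAlg ν L) :
    Filter.Tendsto (fun M => bracketW N W (R * ∏ j, eT M (Q j))) Filter.atTop
      (nhds (expBracketW N W R Q)) := by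
  classical
  rw [expBracketW_eq_sum]
  have hev : (fun M => bracketW N W (R * ∏ j, eT M (Q j))) =ᶠ[Filter.atTop] fun M =>
      ∑ g ∈ Fintype.piFinset fun _ : ι => range (topDegree ν L N + 1),
        (∏ j, es (M - g j) (cst (Q j)) * (((g j).factorial : ℂ)⁻¹)) *
          bracketW N W (R * ∏ j, tail (Q j) ^ (g j)) := by
    filter_upwards [Filter.eventually_ge_atTop (topDegree ν L N)] with M hM
    exact bracketW_mul_prod_eT W Q R hM
  refine Filter.Tendsto.congr' hev.symm ?_
  refine tendsto_finsetSum _ fun g _ => ?_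
  refine Filter.Tendsto.mul_const _ ?_
  exact tendsto_finsetProd _ fun j _ => (tendsto_es_sub (cst (Q j)) (g j)).mul_const _


/-! ### Theorem 3.20 for a general RP weight -/

/-- **Theorem 3.20 (Salmhofer–Seiler; Fröhlich–Israel–Lieb–Simon).**  "Let `⟨·⟩` RP.  For all
`A, B, C_i, D_i ∈ 𝒜_{Λ₊}`,
`|⟨e^{A + ΘB + ∑ C_i ΘD_i}⟩|² ≤ ⟨e^{A + ΘA + ∑ C_i ΘC_i}⟩ ⟨e^{B + ΘB + ∑ D_i ΘD_i}⟩` (3.70).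
Proof. See [19]."  Here for the reflection-positive brackets `[·]_Λ` of the complex spin systems
(site data `f`, bond data `b` with `b_k ≥ 0`, any plane `(i,k)` of the even torus; the
normalisation cancels), in the form: for `X, Y, C_j, D_j ∈ 𝒜_{Λ₊}` and couplings `w_j ≥ 0`,
`|[X · ΘY · e^{∑_j w_j C_j ΘD_j}]|² ≤ [X · ΘX · e^{∑_j w_j C_j ΘC_j}] · [Y · ΘY · e^{∑_j w_j D_j ΘD_j}]`
— the printed statement with `e^A = X`, `e^B = Y` (for the exponentials of `A, B ∈ 𝒜_{Λ₊}` that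
occur, `e^A ∈ 𝒜_{Λ₊}`; the exponential series of the crossing terms is the limit of its partial sums,
`expBracketW`/`tendsto_bracketW_mul_prod_eT`).  Proof as in [19]: expand, apply (3.54) termwise,
Cauchy–Schwarz, resum, pass to the limit. [cite: SalmhoferSeiler1991, Thm. 3.20 (3.70)] -/
theorem expBracketW_schwarz {N : ℕ} {W : FieldAlg ν L} (hW : IsRPWeight i k N W)
    {ι : Type*} [Fintype ι] {w : ι → ℝ} (hw : ∀ j, 0 ≤ w j)
    {X Y : FieldAlg ν L} (hX : X ∈ plusAlgebra i k) (hY : Y ∈ plusAlgebra i k)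
    {C D : ι → FieldAlg ν L} (hC : ∀ j, C j ∈ plusAlgebra i k) (hD : ∀ j, D j ∈ plusAlgebra i k) :
    ‖expBracketW N W (X * reflect i k Y) (crossExp i k w C D)‖ ^ 2 ≤
      (expBracketW N W (X * reflect i k X) (crossExp i k w C C)).re *
        (expBracketW N W (Y * reflect i k Y) (crossExp i k w D D)).re := by
  -- the three convergent sequences
  have ha := tendsto_bracketW_mul_prod_eT (N := N) W (X * reflect i k Y) (crossExp i k w C D)
  have hp := tendsto_bracketW_mul_prod_eT (N := N) W (X * reflect i k X) (crossExp i k w C C)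
  have hq := tendsto_bracketW_mul_prod_eT (N := N) W (Y * reflect i k Y) (crossExp i k w D D)
  simp_rw [← expPartial_eq_prod_eT] at ha hp hq
  refine le_of_tendsto_of_tendsto' ((ha.norm).pow 2)
    (((Complex.continuous_re.tendsto _).comp hp).mul ((Complex.continuous_re.tendsto _).comp hq))
    fun M => ?_
  exact expPartial_schwarzW hW M hw hX hY hC hD

/-- The diagonal exponential brackets `[X · ΘX · e^{∑_j w_j C_j ΘC_j}]` of Thm. 3.20 are real and
nonnegative. [cite: SalmhoferSeiler1991, Thm. 3.20 (3.70)] -/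
theorem expBracketW_diag {N : ℕ} {W : FieldAlg ν L} (hW : IsRPWeight i k N W)
    {ι : Type*} [Fintype ι] {w : ι → ℝ} (hw : ∀ j, 0 ≤ w j)
    {X : FieldAlg ν L} (hX : X ∈ plusAlgebra i k) {C : ι → FieldAlg ν L}
    (hC : ∀ j, C j ∈ plusAlgebra i k) :
    expBracketW N W (X * reflect i k X) (crossExp i k w C C) =
        ((expBracketW N W (X * reflect i k X) (crossExp i k w C C)).re : ℂ) ∧
      0 ≤ (expBracketW N W (X * reflect i k X) (crossExp i k w C C)).re := by
  have hp := tendsto_bracketW_mul_prod_eT (N := N) W (X * reflect i k X) (crossExp i k w C C)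
  simp_rw [← expPartial_eq_prod_eT] at hp
  set p := expBracketW N W (X * reflect i k X) (crossExp i k w C C) with hpdef
  have hreal : ∀ M, bracketW N W (X * reflect i k X * expPartial i k M w C C) =
      ((bracketW N W (X * reflect i k X * expPartial i k M w C C)).re : ℂ) :=
    fun M => (bracketW_expPartial_diag hW M hw hX hC).1
  have hnn : ∀ M, 0 ≤ (bracketW N W (X * reflect i k X * expPartial i k M w C C)).re :=
    fun M => (bracketW_expPartial_diag hW M hw hX hC).2
  have hre : Filter.Tendsto (fun M => (bracketW N W (X * reflect i k X * expPartial i k M w C C)).re)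
      Filter.atTop (nhds p.re) := (Complex.continuous_re.tendsto _).comp hp
  constructor
  · -- `p` is the limit of the real sequence `re p_M`
    have h1 : Filter.Tendsto (fun M => ((bracketW N W (X * reflect i k X * expPartial i k M w C C)).re : ℂ))
        Filter.atTop (nhds ((p.re : ℝ) : ℂ)) := (Complex.continuous_ofReal.tendsto _).comp hre
    have h2 : Filter.Tendsto (fun M => ((bracketW N W (X * reflect i k X * expPartial i k M w C C)).re : ℂ))
        Filter.atTop (nhds p) := by
      refine hp.congr fun M => ?_
      exact hreal M
    exact tendsto_nhds_unique h2 h1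
  · exact ge_of_tendsto' hre hnn


/-! ### The twisted partition functions of a general weight ((3.80), (3.94), (3.96)) -/


/-- **The exponential bracket of a family depends only on the sum of the family**:
`[1 · ∏_j e^{Q_j}]_Λ = e^{∑_j q_j} [e_D^{∑_j (Q_j - q_j)}]_Λ`.
[cite: SalmhoferSeiler1991, Thm. 3.20 (proof)] -/
theorem expBracketW_one_eq {N : ℕ} (W : FieldAlg ν L) {ι : Type*} [Fintype ι]
    (Q : ι → FieldAlg ν L) :
    expBracketW N W 1 Q =
      Complex.exp (∑ j, cst (Q j)) * bracketW N W (eT (topDegree ν L N) (∑ j, tail (Q j))) := by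
  rw [expBracketW, Complex.exp_sum, bracketW_congr_of_nullEq W
    (eT_sum_nullEq (topDegree ν L N) Finset.univ (fun j _ => coeff_zero_tail (Q j))).symm 1, one_mul]

/-- **The twisted partition function of the weight `W`**: `Z^ε_W(φ) = [e^{-N H^ε_Λ(φ)}]_W` (3.80),
rendered through the exponential bracket of the family of site and link terms of `-N H^ε_Λ(φ)`. [cite: SalmhoferSeiler1991, (3.80)] -/
def twistedZW (ε : ℤ) (N : ℕ) (W : FieldAlg ν L) (φ : TorusSite ν L → ℂ) : ℂ :=
  expBracketW N W 1 (hamFamily ε N φ)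


/-- **`Z^ε_Λ(φ) = e^{k₀(φ)} [e_D^{K(φ) - k₀(φ)}]_Λ`**, `K(φ) = -N H^ε_Λ(φ)`, `k₀` its constant term:
the twisted partition function depends on `φ` only through the observable `-N H^ε_Λ(φ)` (3.80).
[cite: SalmhoferSeiler1991, (3.80)] -/
theorem twistedZW_eq (ε : ℤ) (hε : ε = 1 ∨ ε = -1) (N : ℕ) (W : FieldAlg ν L) (φ : TorusSite ν L → ℂ) :
    twistedZW ε N W φ =
      Complex.exp (cst (negNHam ε N φ)) * bracketW N W (eT (topDegree ν L N) (tail (negNHam ε N φ))) := by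
  rw [twistedZW, expBracketW_one_eq, ← sum_hamFamily ε hε N φ]
  congr 2
  · simp [cst, coeff_sum]
  · simp only [tail, coeff_sum, map_sum, Finset.sum_sub_distrib]

/-- **Gaussian domination, the homogeneous case `ε = 1`**: `Z⁺_W(c) = Z⁺_W(0)` for a constant
configuration. [cite: SalmhoferSeiler1991, (3.94)] -/
theorem twistedZW_one_const (N : ℕ) (W : FieldAlg ν L) (c : ℂ) :
    twistedZW (ν := ν) (L := L) 1 N W (fun _ => c) =
      twistedZW (ν := ν) (L := L) 1 N W (fun _ => 0) := by
  rw [twistedZW_eq (ν := ν) (L := L) 1 (Or.inl rfl) N W, twistedZW_eq (ν := ν) (L := L) 1 (Or.inl rfl) N W,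
    negNHam_one_const]

/-- **Gaussian domination, the homogeneous case `ε = -1`**: `Z⁻_Λ(Φ) = Z⁻_Λ(0)` for the staggered
configuration built from an imaginary value (3.96). [cite: SalmhoferSeiler1991, (3.96)] -/
theorem twistedZW_negOne_pattern (hL : 2 ∣ L) (N : ℕ) (W : FieldAlg ν L) {c : ℂ}
    (hc : starRingEnd ℂ c = -c) (p₀ : ZMod 2) :
    twistedZW (ν := ν) (L := L) (-1) N W (pattern hL c p₀) =
      twistedZW (ν := ν) (L := L) (-1) N W (fun _ => 0) := by
  rw [twistedZW_eq (ν := ν) (L := L) (-1) (Or.inr rfl) N W,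
    twistedZW_eq (ν := ν) (L := L) (-1) (Or.inr rfl) N W, negNHam_negOne_pattern hL N hc]


/-! ### The per-plane regrouping (3.84)–(3.89) and the reflection Schwarz inequality (3.90) -/


/-- **Regrouping the exponential bracket**: with two exponential factors in front,
`[e^{A} e^{B} · e^{∑_j Q_j}]_Λ = e^{c₀} [e_D^{T - c₀}]_Λ`, `T = A + B + ∑_j Q_j`, `c₀` its constant
term — the exponential bracket depends only on the total exponent (the exponential series of a sum
is the product of the series, modulo observables invisible to the bracket).
[cite: SalmhoferSeiler1991, Thm. 3.20 (proof) and (3.84)] -/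
theorem expBracketW_expFactor_mul (N : ℕ) (W : FieldAlg ν L) {ι : Type*} [Fintype ι]
    (A B : FieldAlg ν L) (Q : ι → FieldAlg ν L) :
    expBracketW N W (expFactor (topDegree ν L N) A * expFactor (topDegree ν L N) B) Q =
      Complex.exp (cst (A + B + ∑ j, Q j)) *
        bracketW N W (eT (topDegree ν L N) (tail (A + B + ∑ j, Q j))) := by
  classical
  unfold expBracketW expFactor
  have hpoly : C (Complex.exp (cst A)) * eT (topDegree ν L N) (tail A) *
      (C (Complex.exp (cst B)) * eT (topDegree ν L N) (tail B)) *
        ∏ j, eT (topDegree ν L N) (tail (Q j)) =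
      C (Complex.exp (cst A) * Complex.exp (cst B)) *
        (1 * (eT (topDegree ν L N) (tail A) * eT (topDegree ν L N) (tail B) *
          ∏ j, eT (topDegree ν L N) (tail (Q j)))) := by
    rw [map_mul]; ring
  rw [hpoly, bracketW_C_mul]
  have hnull : NullEq (topDegree ν L N) (eT (topDegree ν L N) (tail (A + B + ∑ j, Q j)))
      (eT (topDegree ν L N) (tail A) * eT (topDegree ν L N) (tail B) *
        ∏ j, eT (topDegree ν L N) (tail (Q j))) := by
    rw [tail_add, tail_add, tail_sum]
    refine (eT_add_nullEq (topDegree ν L N) ?_ ?_).trans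
      ((eT_add_nullEq (topDegree ν L N) (coeff_zero_tail A) (coeff_zero_tail B)).mul
        (eT_sum_nullEq (topDegree ν L N) _ fun j _ => coeff_zero_tail (Q j)))
    · rw [coeff_add, coeff_zero_tail, coeff_zero_tail, add_zero]
    · rw [coeff_sum]; exact Finset.sum_eq_zero fun j _ => coeff_zero_tail (Q j)
  rw [← bracketW_congr_of_nullEq W hnull 1, one_mul, cst_add, cst_add, cst_sum,
    Complex.exp_add, Complex.exp_add, Complex.exp_sum]
  ring

variable (i k)

/-- **The twisted partition function as a reflection-split exponential bracket** ((3.84) inside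
(3.80)): `Z^ε_Λ(φ) = [e^{-N H^ε_{Λ₊}(φ)} · Θ e^{-N H^ε_{Λ₊}(φ̄∘r)} · e^{∑ N C_x ΘD_x}]_Λ`, the form to
which Thm. 3.20 applies. [cite: SalmhoferSeiler1991, (3.84)–(3.89)] -/
theorem twistedZW_eq_expBracketW (hL : Even L) (ε : ℤ) (N : ℕ) (W : FieldAlg ν L)
    (ψ : TorusSite ν L → ℂ) :
    twistedZW ε N W ψ =
      expBracketW N W (expFactor (topDegree ν L N) (plusHam i k ε N ψ) *
          reflect i k (expFactor (topDegree ν L N) (plusHam i k ε N (mirrorCfg i k ψ))))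
        (crossExp i k (crossW i k N) (crossC i k ψ) (crossD i k ψ)) := by
  rw [reflect_expFactor', expBracketW_expFactor_mul, ← sum_hamFamily_eq_plusHam hL, twistedZW,
    expBracketW_one_eq, cst_sum, tail_sum]



/-- **(3.90)**: "Using Theorem 3.20 which is applicable because `[·]_Λ` is reflection-positive
(normalization does not matter), one sees that `|F_ε(φ)|² ≤ F_ε(φ₊-symmetrised) F_ε(φ₋-symmetrised)`":
`|Z^ε_Λ(ψ)|² ≤ Z^ε_Λ(ψ on Λ₊, ψ̄∘r on Λ₋) · Z^ε_Λ(ψ̄∘r on Λ₊, ψ on Λ₋)`, for the background bracket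
for every RP weight `W` of the plane `(i, k)` of the even torus.
[cite: SalmhoferSeiler1991, (3.90)] -/
theorem twistedZW_schwarz (hL : Even L) (i : Fin ν) (k : ZMod L) (ε : ℤ) {N : ℕ}
    {W : FieldAlg ν L} (hW : IsRPWeight i k N W) (ψ : TorusSite ν L → ℂ) :
    ‖twistedZW ε N W ψ‖ ^ 2 ≤
      (twistedZW ε N W (cfgSymP i k ψ)).re * (twistedZW ε N W (cfgSymM i k ψ)).re := by
  rw [twistedZW_eq_expBracketW i k hL ε N W ψ, twistedZW_eq_expBracketW i k hL ε N W (cfgSymP i k ψ),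
    twistedZW_eq_expBracketW i k hL ε N W (cfgSymM i k ψ), plusHam_cfgSymP,
    plusHam_mirrorCfg_cfgSymP hL, crossC_cfgSymP, crossD_cfgSymP hL, plusHam_cfgSymM,
    plusHam_mirrorCfg_cfgSymM hL, crossC_cfgSymM, crossD_cfgSymM hL]
  exact expBracketW_schwarz hW (crossW_nonneg N) (expFactor_mem (plusHam_mem ε N ψ))
    (expFactor_mem (plusHam_mem ε N _)) (crossC_mem ψ) (crossD_mem ψ)

/-- The first factor of (3.90) is real and nonnegative. [cite: SalmhoferSeiler1991, (3.90)] -/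
theorem twistedZW_cfgSymP_real (hL : Even L) (i : Fin ν) (k : ZMod L) (ε : ℤ) {N : ℕ}
    {W : FieldAlg ν L} (hW : IsRPWeight i k N W) (ψ : TorusSite ν L → ℂ) :
    twistedZW ε N W (cfgSymP i k ψ) = ((twistedZW ε N W (cfgSymP i k ψ)).re : ℂ) ∧
      0 ≤ (twistedZW ε N W (cfgSymP i k ψ)).re := by
  rw [twistedZW_eq_expBracketW i k hL ε N W (cfgSymP i k ψ), plusHam_cfgSymP,
    plusHam_mirrorCfg_cfgSymP hL, crossC_cfgSymP, crossD_cfgSymP hL]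
  exact expBracketW_diag hW (crossW_nonneg N) (expFactor_mem (plusHam_mem ε N ψ))
    (crossC_mem ψ)

/-- The second factor of (3.90) is real and nonnegative. [cite: SalmhoferSeiler1991, (3.90)] -/
theorem twistedZW_cfgSymM_real (hL : Even L) (i : Fin ν) (k : ZMod L) (ε : ℤ) {N : ℕ}
    {W : FieldAlg ν L} (hW : IsRPWeight i k N W) (ψ : TorusSite ν L → ℂ) :
    twistedZW ε N W (cfgSymM i k ψ) = ((twistedZW ε N W (cfgSymM i k ψ)).re : ℂ) ∧
      0 ≤ (twistedZW ε N W (cfgSymM i k ψ)).re := by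
  rw [twistedZW_eq_expBracketW i k hL ε N W (cfgSymM i k ψ), plusHam_cfgSymM,
    plusHam_mirrorCfg_cfgSymM hL, crossC_cfgSymM, crossD_cfgSymM hL]
  exact expBracketW_diag hW (crossW_nonneg N) (expFactor_mem (plusHam_mem ε N _))
    (crossD_mem ψ)

/-- **`Z^ε_Λ(0)` is real and nonnegative** (it is a diagonal exponential bracket; torus of positive
dimension). [cite: SalmhoferSeiler1991, (3.80) and (3.90)] -/
theorem twistedZW_zero_real (hL : Even L) (i : Fin ν) (k : ZMod L) (ε : ℤ) {N : ℕ}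
    {W : FieldAlg ν L} (hW : IsRPWeight i k N W) :
    twistedZW ε N W (fun _ : TorusSite ν L => (0 : ℂ)) =
        ((twistedZW ε N W (fun _ : TorusSite ν L => (0 : ℂ))).re : ℂ) ∧
      0 ≤ (twistedZW ε N W (fun _ : TorusSite ν L => (0 : ℂ))).re := by
  have h := twistedZW_cfgSymP_real hL i k ε hW (fun _ => 0)
  rwa [cfgSymP_zero] at h

omit [NeZero L] in
/-- The norm of a real nonnegative complex number is its real part. [folklore] -/
private theorem norm_eq_re_of_eq' {z : ℂ} (h : z = (z.re : ℂ)) (h0 : 0 ≤ z.re) : ‖z‖ = z.re := by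
  rw [h, Complex.ofReal_re, Complex.norm_real, Real.norm_of_nonneg h0]

/-- **The chessboard bound (3.91)–(3.93) for `|Z^ε_Λ|`**: every configuration with values in a finite
conjugation-closed set `S` is dominated by a homogeneous one, `|Z^ε_Λ(φ)| ≤ |Z^ε_Λ(Φ^{(c)})|`.
[cite: SalmhoferSeiler1991, (3.91)–(3.93)] -/
theorem norm_twistedZW_le_pattern (hL : Even L) (ε : ℤ) {N : ℕ} {W : FieldAlg ν L}
    (hW : ∀ (i : Fin ν) (k : ZMod L), IsRPWeight i k N W) {S : Finset ℂ} (hS : ∀ c ∈ S, starRingEnd ℂ c ∈ S)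
    {φ : TorusSite ν L → ℂ} (hφ : ∀ y, φ y ∈ S) :
    ∃ c ∈ S, ∃ p₀ : ZMod 2,
      ‖twistedZW ε N W φ‖ ≤ ‖twistedZW ε N W (pattern (ν := ν) hL.two_dvd c p₀)‖ := by
  refine chessboard_cfg hL hS (F := fun ψ => ‖twistedZW ε N W ψ‖) (fun _ => norm_nonneg _)
    (fun i k ψ _ => ?_) hφ (fun _ => 0)
  obtain ⟨hP, hP0⟩ := twistedZW_cfgSymP_real hL i k ε (hW i k) ψ
  obtain ⟨hM, hM0⟩ := twistedZW_cfgSymM_real hL i k ε (hW i k) ψ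
  show ‖twistedZW ε N W ψ‖ ^ 2 ≤ ‖twistedZW ε N W (cfgSymP i k ψ)‖ * ‖twistedZW ε N W (cfgSymM i k ψ)‖
  rw [norm_eq_re_of_eq' hP hP0, norm_eq_re_of_eq' hM hM0]
  exact twistedZW_schwarz hL i k ε (hW i k) ψ

/-- **Gaussian domination, `ε = 1` (3.95)**: "For `ε = 1`, take `φ_x ∈ ℝ` for all `x`, then `Φ^{(x)}`
is a constant configuration, and `H⁺_Λ(Φ^{(x)}) = H⁺_Λ(0)`, that is, `Z⁺_Λ(Φ^{(x)}) = Z_Λ` and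
consequently Gaussian domination `|Z⁺_Λ(φ)| ≤ Z_Λ` holds" — here `|Z⁺_Λ(φ)| ≤ |Z⁺_Λ(0)|` for every real
configuration, for every weight `W` that is RP for all planes.
[cite: SalmhoferSeiler1991, (3.94)–(3.95)] -/
theorem gaussianDominationW_one (hL : Even L) {N : ℕ} {W : FieldAlg ν L}
    (hW : ∀ (i : Fin ν) (k : ZMod L), IsRPWeight i k N W) {φ : TorusSite ν L → ℂ} (hφ : ∀ y, starRingEnd ℂ (φ y) = φ y) :
    ‖twistedZW 1 N W φ‖ ≤ ‖twistedZW 1 N W (fun _ : TorusSite ν L => (0 : ℂ))‖ := by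
  classical
  have hS : ∀ c ∈ Finset.univ.image φ, starRingEnd ℂ c ∈ Finset.univ.image φ := by
    intro c hc
    obtain ⟨y, -, rfl⟩ := Finset.mem_image.1 hc
    rw [hφ y]
    exact Finset.mem_image_of_mem φ (Finset.mem_univ y)
  obtain ⟨c, hc, p₀, hle⟩ := norm_twistedZW_le_pattern hL 1 hW hS
    (fun y => Finset.mem_image_of_mem φ (Finset.mem_univ y))
  obtain ⟨y, -, rfl⟩ := Finset.mem_image.1 hc
  have hconst : pattern (ν := ν) hL.two_dvd (φ y) p₀ = fun _ => φ y :=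
    funext fun z => by unfold pattern; rw [hφ y, ite_self]
  rwa [hconst, twistedZW_one_const] at hle

/-- **Gaussian domination, `ε = -1` (3.97)**: "For `ε = -1`, take `φ_x ∈ iℝ`, then `Φ^{(x)}` is a
staggered configuration. Since `H⁻_Λ` is formally antiferromagnetic, `Z⁻_Λ(Φ^{(x)}) = Z_Λ`, and thus
`|Z⁻_Λ(φ)| ≤ Z_Λ`" — here `|Z⁻_Λ(φ)| ≤ |Z⁻_Λ(0)|` for every imaginary configuration.
[cite: SalmhoferSeiler1991, (3.96)–(3.97)] -/
theorem gaussianDominationW_negOne (hL : Even L) {N : ℕ} {W : FieldAlg ν L}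
    (hW : ∀ (i : Fin ν) (k : ZMod L), IsRPWeight i k N W) {φ : TorusSite ν L → ℂ} (hφ : ∀ y, starRingEnd ℂ (φ y) = -φ y) :
    ‖twistedZW (-1) N W φ‖ ≤ ‖twistedZW (-1) N W (fun _ : TorusSite ν L => (0 : ℂ))‖ := by
  classical
  set S : Finset ℂ := Finset.univ.image φ ∪ Finset.univ.image (fun y => -φ y) with hSdef
  have hS : ∀ c ∈ S, starRingEnd ℂ c ∈ S := by
    intro c hc
    rcases Finset.mem_union.1 hc with h | h
    · obtain ⟨y, -, rfl⟩ := Finset.mem_image.1 h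
      rw [hφ y]
      exact Finset.mem_union_right _ (Finset.mem_image_of_mem (fun y => -φ y) (Finset.mem_univ y))
    · obtain ⟨y, -, rfl⟩ := Finset.mem_image.1 h
      rw [map_neg, hφ y, neg_neg]
      exact Finset.mem_union_left _ (Finset.mem_image_of_mem φ (Finset.mem_univ y))
  have hSc : ∀ c ∈ S, starRingEnd ℂ c = -c := by
    intro c hc
    rcases Finset.mem_union.1 hc with h | h
    · obtain ⟨y, -, rfl⟩ := Finset.mem_image.1 h
      exact hφ y
    · obtain ⟨y, -, rfl⟩ := Finset.mem_image.1 h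
      rw [map_neg, hφ y]
  have hφS : ∀ y, φ y ∈ S := fun y =>
    Finset.mem_union_left _ (Finset.mem_image_of_mem φ (Finset.mem_univ y))
  obtain ⟨c, hc, p₀, hle⟩ := norm_twistedZW_le_pattern hL (-1) hW hS hφS
  rwa [twistedZW_negOne_pattern hL.two_dvd N W (hSc c hc) p₀] at hle

end ComplexSpin

end Literature.MathematicalPhysics.StatisticalMechanics

end
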